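import Summits.KontsevichZagierPeriods.KontsevichZagierPeriods.Theses.TerasomaMultiplication
import Summits.KontsevichZagierPeriods.KontsevichZagierPeriods.Theorems.CompleteModGammaSector.Negative.LoadBearing
import Literature.NumberTheory.Transcendental.KZProductIdeal

/-!
# `CompleteModGammaSector` (stmt-KontsevichZagierPeriods-14233), line `Sketch` (card
# wronskian-transport): stub `stub_spectatorStabilityCubes`

The provable Beta-cube case of seam 3 (spectator stability): prefixing an admissible Beta cube
`s = [(0,1)^M, Π_j t_j^{a_j−1}(1−t_j)^{b_j−1}]` to both sides of a Deligne–Koblitz–Ogus pair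
`[ρ] − [ρ']` (a generator of `gammaHodgePairs`) gives again such a pair, up to one
coordinate-permutation move: `[s]·[ρ] = [s.prod ρ]` IS the cube Beta representation with
exponents `(Fin.append a x, Fin.append b y)` (`isCubeBetaRep_prod`); `[s]·[ρ'] = [s.prod ρ']` has
blocks (cube `M`, ball `2k`, cube `N'`), and reindexing along the block permutation `e` of
`exists_blockPerm` (ball to the front; a change-of-variables move,
`KZ.of_sub_of_reindex_mem_relations`) gives the ball × cube representation with exponents
`(Fin.append a x', Fin.append b y')` and the same constant `c` (`isBallCubeRep_prod_reindex`).
Admissibility is blockwise, Koblitz–Ogus sums add over blocks (`hodgeSum_append`, so the Hodge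
difference is still `k`), values multiply (`KZ.IntegralRep.value_prod`, `value_reindex`). Hence
`[s]·([ρ] − [ρ']) ∈ relations ⊔ closure gammaHodgePairs = sector` (`stub_spectatorStabilityCubes`).
-/

noncomputable section

-- `Summit.KontsevichZagierPeriods.KontsevichZagierPeriods.…` is the tree's mandated layout (single-conjunct summit).
set_option linter.dupNamespace false

namespace Summit.KontsevichZagierPeriods.KontsevichZagierPeriods.CompleteModGammaSectorLine

open MeasureTheory Set
open Literature.NumberTheory.Transcendental
open Literature.NumberTheory.Transcendental.KZ
open Summit.KontsevichZagierPeriods.CompleteModGammaSectorNegative (gammaHodgePairs sector)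
open Summit.KontsevichZagierPeriods.GammaHodgeSectorNegative

/-! ## Block bookkeeping on the exponent data -/

/-- Admissibility is preserved under concatenation of exponent data. [folklore] -/
theorem admissible_append {M N : ℕ} {a b : Fin M → ℚ} {x y : Fin N → ℚ}
    (ha : Admissible a b) (hx : Admissible x y) : Admissible (Fin.append a x) (Fin.append b y) := by
  intro j
  refine Fin.addCases (fun i => ?_) (fun i => ?_) j
  · simpa only [Fin.append_left] using ha i
  · simpa only [Fin.append_right] using hx i

/-- The coprimality guard of concatenated data restricts to the right block. [folklore] -/
theorem coprimeDen_right_of_append {M N : ℕ} {a b : Fin M → ℚ} {x y : Fin N → ℚ} {u : ℕ}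
    (h : CoprimeDen (Fin.append a x) (Fin.append b y) u) : CoprimeDen x y u := by
  intro i
  simpa only [Fin.append_right] using h (Fin.natAdd M i)

/-- Koblitz–Ogus sums add over blocks of concatenated data. [folklore] -/
theorem hodgeSum_append {M N : ℕ} (a b : Fin M → ℚ) (x y : Fin N → ℚ) (u : ℕ) :
    hodgeSum (Fin.append a x) (Fin.append b y) u = hodgeSum a b u + hodgeSum x y u := by
  simp only [hodgeSum, Fin.sum_univ_add, Fin.append_left, Fin.append_right]

/-- The Hodge-type condition survives prefixing the same block to both exponent data: the common
block cancels in the difference of Koblitz–Ogus sums, and the coprimality guards restrict to the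
original blocks. [folklore] -/
theorem hodgeCondition_append {M N N' k : ℕ} (a b : Fin M → ℚ) {x y : Fin N → ℚ}
    {x' y' : Fin N' → ℚ} (hH : HodgeCondition N N' k x y x' y') :
    HodgeCondition (M + N) (M + N') k (Fin.append a x) (Fin.append b y) (Fin.append a x')
      (Fin.append b y') := by
  intro u hu h1 h2
  have h := hH u hu (coprimeDen_right_of_append h1) (coprimeDen_right_of_append h2)
  rw [hodgeSum_append, hodgeSum_append]
  linarith

/-! ## The block permutation -/

/-- The coordinate permutation `(M-block, K-block, N'-block) ↦ (K-block, M-block, N'-block)` of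
`Fin (M + (K + N')) ≃ Fin (K + (M + N'))`, with its three evaluation rules. [folklore] -/
theorem exists_blockPerm (M K N' : ℕ) :
    ∃ e : Fin (M + (K + N')) ≃ Fin (K + (M + N')),
      (∀ i : Fin M, e (Fin.castAdd (K + N') i) = Fin.natAdd K (Fin.castAdd N' i)) ∧
      (∀ i : Fin K, e (Fin.natAdd M (Fin.castAdd N' i)) = Fin.castAdd (M + N') i) ∧
      (∀ l : Fin N', e (Fin.natAdd M (Fin.natAdd K l)) = Fin.natAdd K (Fin.natAdd M l)) := by
  refine ⟨finSumFinEquiv.symm.trans (((Equiv.refl (Fin M)).sumCongr finSumFinEquiv.symm).trans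
    ((Equiv.sumAssoc (Fin M) (Fin K) (Fin N')).symm.trans
      (((Equiv.sumComm (Fin M) (Fin K)).sumCongr (Equiv.refl (Fin N'))).trans
        ((Equiv.sumAssoc (Fin K) (Fin M) (Fin N')).trans
          (((Equiv.refl (Fin K)).sumCongr finSumFinEquiv).trans finSumFinEquiv))))), ?_, ?_, ?_⟩
  · intro i; simp
  · intro i; simp
  · intro l; simp

/-! ## The two sides of the prefixed pair -/

/-- Prefixing a Beta cube to a Beta cube gives the Beta cube with concatenated exponents (Fubini
product: `KZ.IntegralRep.prod_domain`, `KZ.IntegralRep.prod_integrand_eq`). [folklore] -/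
theorem isCubeBetaRep_prod {M N : ℕ} {a b : Fin M → ℚ} {x y : Fin N → ℚ} {s : IntegralRep M}
    {ρ : IntegralRep N} (hs : IsCubeBetaRep a b s) (hρ : IsCubeBetaRep x y ρ) :
    IsCubeBetaRep (Fin.append a x) (Fin.append b y) (s.prod ρ) := by
  refine ⟨?_, ?_⟩
  · ext z
    simp only [IntegralRep.prod_domain, IntegralRep.mem_prodDomain, mem_setOf_eq]
    rw [hs.1, hρ.1]
    simp only [mem_setOf_eq]
    exact (Fin.forall_fin_add (fun j => z j ∈ Ioo (0:ℝ) 1)).symm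
  · intro z hz
    have hz' : (fun i => z (Fin.castAdd N i)) ∈ s.domain ∧
        (fun j => z (Fin.natAdd M j)) ∈ ρ.domain := hz
    rw [IntegralRep.prod_integrand_eq, IntegralRep.prodFun_apply, hs.2 hz'.1, hρ.2 hz'.2]
    simp only [Fin.prod_univ_add, Fin.append_left, Fin.append_right]

/-- Prefixing a Beta cube to a ball × cube representation and moving the ball block to the front
(reindexing along a block permutation `e` with the three stated evaluation rules) gives the
ball × cube representation with concatenated exponents and the same constant. [folklore] -/
theorem isBallCubeRep_prod_reindex {M N' k : ℕ} {a b : Fin M → ℚ} {x' y' : Fin N' → ℚ} {c : ℝ}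
    {s : IntegralRep M} {ρ' : IntegralRep (2 * k + N')} (hs : IsCubeBetaRep a b s)
    (hρ' : IsBallCubeRep k x' y' c ρ') (e : Fin (M + (2 * k + N')) ≃ Fin (2 * k + (M + N')))
    (he₁ : ∀ i : Fin M, e (Fin.castAdd (2 * k + N') i) = Fin.natAdd (2 * k) (Fin.castAdd N' i))
    (he₂ : ∀ i : Fin (2 * k), e (Fin.natAdd M (Fin.castAdd N' i)) = Fin.castAdd (M + N') i)
    (he₃ : ∀ l : Fin N',
      e (Fin.natAdd M (Fin.natAdd (2 * k) l)) = Fin.natAdd (2 * k) (Fin.natAdd M l)) :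
    IsBallCubeRep k (Fin.append a x') (Fin.append b y') c ((s.prod ρ').reindex e) := by
  refine ⟨?_, ?_⟩
  · ext w
    simp only [IntegralRep.reindex_domain, IntegralRep.prod_domain, IntegralRep.mem_prodDomain,
      mem_setOf_eq]
    rw [hs.1, hρ'.1]
    simp only [mem_setOf_eq, he₁, he₂, he₃]
    constructor
    · rintro ⟨h₁, h₂, h₃⟩
      exact ⟨h₂,
        (Fin.forall_fin_add (fun l => w (Fin.natAdd (2 * k) l) ∈ Ioo (0:ℝ) 1)).mpr ⟨h₁, h₃⟩⟩
    · rintro ⟨h₂, h⟩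
      exact ⟨fun i => h (Fin.castAdd N' i), h₂, fun l => h (Fin.natAdd M l)⟩
  · intro w hw
    have hw' : (fun i => w (e (Fin.castAdd (2 * k + N') i))) ∈ s.domain ∧
        (fun j => w (e (Fin.natAdd M j))) ∈ ρ'.domain := hw
    rw [IntegralRep.reindex_integrand]
    simp only
    rw [IntegralRep.prod_integrand_eq, IntegralRep.prodFun_apply, hs.2 hw'.1, hρ'.2 hw'.2]
    simp only [he₁, he₃, Fin.prod_univ_add, Fin.append_left, Fin.append_right]
    ring

/-- Reindexing does not change the value (it is a move, and moves are sound: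
`KZ.of_sub_of_reindex_mem_relations`, `KZ.relations_le_ker_eval_holds`). [folklore] -/
theorem value_reindex {N K : ℕ} (σ : IntegralRep N) (e : Fin N ≃ Fin K) :
    (σ.reindex e).value = σ.value := by
  -- adapted from `value_reindex` (Cruxes/GammaSectorComplete/SketchIdeator3.lean §C)
  have h : eval (of σ - of (σ.reindex e)) = 0 :=
    relations_le_ker_eval_holds (of_sub_of_reindex_mem_relations σ e)
  rw [eval_of_sub_of, sub_eq_zero] at h
  exact h.symm

/-! ## The stub -/

/-- **Stub `stub_spectatorStabilityCubes` (the Beta-cube case of seam 3, spectator stability):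
CUBE-BETA spectators are absorbed by the Γ-sector** — prefixing the same admissible Beta cube
`[(0,1)^M, Π t^{a−1}(1−t)^{b−1}]` to both sides of a Deligne–Koblitz–Ogus pair gives, after one
coordinate-permutation move on the ball × cube side, again such a pair (exponent lists
concatenate, Hodge sums add, the constant `c` is unchanged, values multiply), so
`[s]·([ρ] − [ρ']) ∈ relations ⊔ closure gammaHodgePairs = sector`.
[cite: Deligne1982HodgeCycles, Thm. 7.18] -/
theorem stub_spectatorStabilityCubes :
    ∀ (M : ℕ) (a b : Fin M → ℚ) (s : IntegralRep M),
      Summit.KontsevichZagierPeriods.GammaHodgeSectorNegative.Admissible a b →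
      Summit.KontsevichZagierPeriods.GammaHodgeSectorNegative.IsCubeBetaRep a b s →
      ∀ d : FormalRep, d ∈ gammaHodgePairs → of s * d ∈ sector := by
  intro M a b s ha hs d hd
  obtain ⟨N, N', k, x, y, x', y', c, ρ, ρ', hx, hx', hH, hc, hρ, hρ', hv, rfl⟩ :=
    CompleteModGammaSectorNegative.mem_gammaHodgePairs_iff.mp hd
  obtain ⟨e, he₁, he₂, he₃⟩ := exists_blockPerm M (2 * k) N'
  have hpair : of (s.prod ρ) - of ((s.prod ρ').reindex e) ∈ sector :=
    CompleteModGammaSectorNegative.of_sub_of_mem_sector_of_pair (admissible_append ha hx)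
      (admissible_append ha hx') (hodgeCondition_append a b hH) hc (isCubeBetaRep_prod hs hρ)
      (isBallCubeRep_prod_reindex hs hρ' e he₁ he₂ he₃)
      (by rw [IntegralRep.value_prod, value_reindex, IntegralRep.value_prod, hv])
  have hrel : of (s.prod ρ') - of ((s.prod ρ').reindex e) ∈ sector :=
    AddSubgroup.mem_sup_left (of_sub_of_reindex_mem_relations _ e)
  have hmem := sector.sub_mem hpair hrel
  rw [mul_sub, of_mul_of, of_mul_of]
  convert hmem using 1
  abel

end Summit.KontsevichZagierPeriods.KontsevichZagierPeriods.CompleteModGammaSectorLine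

end
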